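import Summits.ABC.IUTFork.Cor312PossibleImagesSlotNormConst
import Summits.ABC.IUTFork.Cor312SlotLicenceSingletonFibresM
import Summits.ABC.IUTFork.Cor312VolumesPadicLatticeScaled
import Summits.ABC.IUTFork.Cor312ThetaSlotExactM
import HarnessLib

/-!
# [IUTchIII] Cor. 3.12 over the typed setting, M LINE — readings (U) and (P) COINCIDE AS POSSIBLE-IMAGE FAMILIES at abc-iut-s2-p8's
# summand-route sharp setting `settingPrVolSharpM` when the Θ-idele norms are constant on each fibre — so at EVERY genuine datum over a rational point

PROOF-ONLY file (D-0012; 0 definitions, 0 `Prop` facts, no instance, no notation) of the abc-iut cell (branch C certificate seat abc-iut-C-cert-2,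
gen 5; row «C:PU-IMAGES-COINCIDE», M twin of `Cor312PossibleImagesSlotNormConst`, p489130). TAKES NO SIDE on [IUTchIII] Cor. 3.12 (kurims manuscript
p. 173–174; Thm. 3.11 (i) (Ind1)(Ind2) p. 154; Step (x) p. 181; Step (xi-f) p. 184) or on the reading (U)/(P); every statement is about OUR typed objects
(abc-iut-w5-d166's M-level shells `Real.logShellsOfInitialDH` = `toDH` of the M-level signature, [IUTchI] Def. 3.1 (e); abc-iut-s2-p8's `Real.settingPrVolSharpM`
over the presentation `presAtM`; this seat's gen-3 (P)-side objects `Setting.thetaSlotImages` / `thetaSlotHull` / `SlotLicence` / `negLogThetaSlot` / `SlotStatement`).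

* §1 (Ind1)/(Ind2) bookkeeping of the M-LEVEL Dupuy–Hilado shells: `LogShells.mul_mem_dhIsm` / `inv_mem_dhIsm` (the `toDH` Ism slot — bicontinuous
  shell-preserving `ℚ`-linear automorphisms at finite places, `{±1}` at infinite ones — is closed under composition and inverse), the trivial strip slot,
  and `Real.exists_perm_of_mem_Ind1_logShellsOfInitialDH` ((Ind1) = capsule permutations, Dupuy–Hilado §4.7).
* §2 `Real.permute_image_thetaRegion3_settingPrVolSharpM_eq_of_norm_const` — a capsule permutation FIXES the sharp (Ind3)-region of `settingPrVolSharpM`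
  when `‖t_{Θ,i,x}‖` is constant on each fibre `V̲_u` (abc-iut-c312-5's generic `PadicPresentation.comparison_permute` / `permΨ_image_pi`, abc-iut-w5-d216's
  `permX_image_iota_smul_normalizedPacket`, abc-iut-c312-d1's `iota_smul_normalizedPacket_eq_of_norm_eq`; at `∞` the region is everything), and
  **`Real.possibleImages_settingPrVolSharpM_eq_thetaSlotImages`** (abc-iut-c312-1's `LogShells.image_closure_eq`): (U) = (P) as image families; transfer to
  `thetaHull` / `Licence` / `negLogTheta` / `Statement` by p489130's `Setting.…_of_images` lemmas; and **READ-U-M EXACT**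
  `negLogTheta_settingPrVolSharpM_tOfIdeleData_eq_negLogThetaPerImageNonarch_of_norm_const` (gen 4's READ-P-M p469199 transported to reading (U)).
* §3 **`Conditional.GenuineMSlot.possibleImages_eq_thetaSlotImages_of_dmod_eq_one`** — at EVERY genuine Θ-volume datum `T` over a point with `d_mod = 1` the
  fibres `V̲_u` are subsingletons (gen 4 `GenuineMSlot.fibre_subsingleton_of_dmod_eq_one`), so norm constancy is automatic for EVERY Θ-idele family: for the M
  books' setting (ANY `t`, `tq`, `Sq`, context binders) `possibleImages = thetaSlotImages`, `negLogThetaSlot = negLogTheta`, `SlotStatement ↔ Statement` —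
  READ-P-M (gen 4 `Cor312ThetaSlotExactM`, p469199) is READ-U-M at every tabulated datum.

HONEST SCOPE: identities between OUR typed objects under a stated norm-constancy hypothesis (automatic at d_mod = 1 on the M line); nothing identifies the
author's intended hull or bears on the printed GLOBAL inequality; decided-as-typed ≠ in print; typed ≠ proved (this: proved). [cite: Mochizuki2012, IUTchIII
Thm. 3.11 (i) p. 154, Cor. 3.12 p. 173–174, Step (x) p. 181, Step (xi-f) p. 184, Rmk. 3.9.5 (i) p. 127; IUTchI §0 p. 33, Def. 3.1 (e) p. 62]
[cite: DupuyHilado2025, §4.7, §4.9, §4.11, §4.12] [claim: Mochizuki2012, status: disputed] for every IUT sentence quoted.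
-/

noncomputable section

open Set Function NumberField IsDedekindDomain
open scoped Pointwise

namespace Summit.ABC.IUTFork

/-! ## §1. (Ind1)/(Ind2) bookkeeping for `toDH` shells -/

namespace Thm311.LogShells

open Literature.IUT.LogThetaLattice

variable {T : ThetaIndex} (L : LogShells T) (τ : ∀ v : T.V, TopologicalSpace (L.carrier v))

/-- **(HI) for the `toDH` Ism slot**: `LogShells.dhIsm` is closed under composition. [cite: DupuyHilado2025, §4.9] -/
theorem mul_mem_dhIsm (v : T.V) : ∀ a ∈ L.dhIsm τ v, ∀ b ∈ L.dhIsm τ v, a * b ∈ L.dhIsm τ v := by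
  intro a ha b hb
  unfold dhIsm at ha hb ⊢
  by_cases hn : T.IsNon (T.over v)
  · rw [if_pos hn] at ha hb ⊢
    obtain ⟨ha1, ha2, ha3⟩ := ha
    obtain ⟨hb1, hb2, hb3⟩ := hb
    refine ⟨?_, ?_, ?_⟩
    · show @Continuous _ _ (τ v) (τ v) (fun z => a (b z))
      exact @Continuous.comp _ _ _ (τ v) (τ v) (τ v) _ _ ha1 hb1
    · show @Continuous _ _ (τ v) (τ v) (fun z => b.symm (a.symm z))
      exact @Continuous.comp _ _ _ (τ v) (τ v) (τ v) _ _ hb2 ha2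
    · show (⇑a ∘ ⇑b) '' L.shell v = L.shell v
      rw [Set.image_comp, hb3, ha3]
  · rw [if_neg hn] at ha hb ⊢
    simp only [Set.mem_insert_iff, Set.mem_singleton_iff] at ha hb ⊢
    rcases ha with rfl | rfl <;> rcases hb with rfl | rfl
    · exact Or.inl rfl
    · exact Or.inr rfl
    · exact Or.inr (LinearEquiv.ext fun x => rfl)
    · exact Or.inl (LinearEquiv.ext fun x => neg_neg x)

/-- **(HI′)**: `LogShells.dhIsm` is closed under inverse. [cite: DupuyHilado2025, §4.9] -/
theorem inv_mem_dhIsm (v : T.V) : ∀ a ∈ L.dhIsm τ v, a⁻¹ ∈ L.dhIsm τ v := by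
  intro a ha
  unfold dhIsm at ha ⊢
  by_cases hn : T.IsNon (T.over v)
  · rw [if_pos hn] at ha ⊢
    obtain ⟨ha1, ha2, ha3⟩ := ha
    refine ⟨ha2, ?_, ?_⟩
    · show @Continuous _ _ (τ v) (τ v) (fun z => a.symm.symm z)
      simpa only [LinearEquiv.symm_symm] using ha1
    · show a.symm '' L.shell v = L.shell v
      conv_lhs => rw [← ha3]
      rw [Set.image_image]
      simp only [LinearEquiv.symm_apply_apply, Set.image_id']
  · rw [if_neg hn] at ha ⊢
    simp only [Set.mem_insert_iff, Set.mem_singleton_iff] at ha ⊢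
    rcases ha with rfl | rfl
    · exact Or.inl rfl
    · exact Or.inr (LinearEquiv.ext fun x => rfl)

/-- (HS)(HS′)(HN) for the trivial strip slot `{1}` of `toDH`, and (HI)(HI′): the five hypotheses of abc-iut-c312-1's `image_closure_eq` hold for
EVERY `toDH` instance. [cite: DupuyHilado2025, §4.7, §4.9] -/
theorem toDH_closure_hyps :
    (∀ v, ∀ a ∈ (L.toDH τ).stripAut v, ∀ b ∈ (L.toDH τ).stripAut v, a * b ∈ (L.toDH τ).stripAut v) ∧
    (∀ v, ∀ a ∈ (L.toDH τ).stripAut v, a⁻¹ ∈ (L.toDH τ).stripAut v) ∧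
    (∀ v, ∀ a ∈ (L.toDH τ).stripAut v, ∀ g ∈ (L.toDH τ).ism v, a * g * a⁻¹ ∈ (L.toDH τ).ism v) ∧
    (∀ v, ∀ a ∈ (L.toDH τ).ism v, ∀ b ∈ (L.toDH τ).ism v, a * b ∈ (L.toDH τ).ism v) ∧
    (∀ v, ∀ a ∈ (L.toDH τ).ism v, a⁻¹ ∈ (L.toDH τ).ism v) := by
  refine ⟨fun v a ha b hb => ?_, fun v a ha => ?_, fun v a ha g hg => ?_, fun v => L.mul_mem_dhIsm τ v, fun v => L.inv_mem_dhIsm τ v⟩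
  · have ha' : a = LinearEquiv.refl ℚ ((L.toDH τ).carrier v) := ha
    have hb' : b = LinearEquiv.refl ℚ ((L.toDH τ).carrier v) := hb
    subst ha'; subst hb'
    show LinearEquiv.refl ℚ ((L.toDH τ).carrier v) * LinearEquiv.refl ℚ ((L.toDH τ).carrier v) ∈ (L.toDH τ).stripAut v
    exact (rfl : _ = LinearEquiv.refl ℚ ((L.toDH τ).carrier v))
  · have ha' : a = LinearEquiv.refl ℚ ((L.toDH τ).carrier v) := ha
    subst ha'
    exact (rfl : _ = LinearEquiv.refl ℚ ((L.toDH τ).carrier v))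
  · have ha' : a = LinearEquiv.refl ℚ ((L.toDH τ).carrier v) := ha
    subst ha'
    have h1 : (LinearEquiv.refl ℚ ((L.toDH τ).carrier v)) * g * (LinearEquiv.refl ℚ ((L.toDH τ).carrier v))⁻¹ = g := by
      ext z; rfl
    rw [h1]
    exact hg

/-- **(Ind1) of a `toDH` instance = the capsule permutations** (strip slot trivial; Dupuy–Hilado §4.7): a family in `Ind1 j` is `v_ℚ ↦ permute σ` for ONE
`σ`. [cite: DupuyHilado2025, §4.7] -/
theorem exists_perm_of_mem_Ind1_toDH {j : T.Label} {Φ : ∀ vQ : T.VQ, (L.toDH τ).Packet j vQ ≃ₗ[ℚ] (L.toDH τ).Packet j vQ}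
    (hΦ : Φ ∈ (L.toDH τ).Ind1 j) : ∃ σ : Equiv.Perm (T.Caps j), ∀ vQ, Φ vQ = (L.toDH τ).permute j vQ σ := by
  obtain ⟨σ, h, hh, hΦ⟩ := hΦ
  refine ⟨σ, fun vQ => ?_⟩
  have hrefl : (fun i => (L.toDH τ).summandwise vQ fun v : T.Fibre vQ => h i v.1) =
      fun _ => LinearEquiv.refl ℚ ((L.toDH τ).Packet1 vQ) := by
    funext i
    have : (fun v : T.Fibre vQ => h i v.1) = fun v : T.Fibre vQ => LinearEquiv.refl ℚ ((L.toDH τ).carrier v.1) := by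
      funext v
      exact (hh i v.1 : h i v.1 = LinearEquiv.refl ℚ _)
    rw [this]
    exact (L.toDH τ).summandwise_refl vQ
  rw [hΦ vQ, hrefl, LogShells.factorwise_refl]
  rfl

end Thm311.LogShells

/-! ## §2. `settingPrVolSharpM`: under norm constancy (Ind1) fixes the (Ind3)-region, so (U) = (P) -/

namespace Thm311.Real

open Cor312 Cor312.Setting Cor312Vol Literature.IUT.LogThetaLattice Literature.IUT.LogVolume Literature.IUT.HodgeTheaters
variable {F K Fbar : Type} [Field F] [NumberField F] [Field K] [NumberField K] [Algebra F K]
  [Field Fbar] [Algebra F Fbar] [Algebra K Fbar] {E : WeierstrassCurve F} [E.IsElliptic] {l : ℕ}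
  {Pb : BadPlacePredicates K} (D : InitialThetaData F K Fbar E l Pb) {logvK : PadicLogsVal K}
  (hlog : LogvAnalyticVal logvK)
  (M : Type) [Field M] [NumberField M]
  (archPk : ∀ (j : (thetaIndexOfInitial D).Label) (vQ : (thetaIndexOfInitial D).VQ),
    Set ((logShellsOfInitialDH D logvK).Packet j vQ))
  (archSub : ∀ (j : (thetaIndexOfInitial D).Label) (v : (thetaIndexOfInitial D).V),
    Set ((logShellsOfInitialDH D logvK).Packet j ((thetaIndexOfInitial D).over v)))
  (Ψ : ℤ → ∀ v : (thetaIndexOfInitial D).V, v ∈ (thetaIndexOfInitial D).Vbad →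
    Set ((logShellsOfInitialDH D logvK).StarPacket v))
  (act : ℤ → ∀ v : (thetaIndexOfInitial D).V, v ∈ (thetaIndexOfInitial D).Vbad →
    (logShellsOfInitialDH D logvK).StarPacket v → Module.End ℚ ((logShellsOfInitialDH D logvK).StarPacket v))
  (Mmod : ℤ → ∀ j : (thetaIndexOfInitial D).LabelStar, Set ((logShellsOfInitialDH D logvK).GlobalPacket j.1))
  (region : ℤ → ∀ j : (thetaIndexOfInitial D).LabelStar, FinDivisor M → ∀ vQ : (thetaIndexOfInitial D).VQ,
    Set ((logShellsOfInitialDH D logvK).Packet j.1 vQ))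
  (n : ℤ) {HT : Type} {LogLink : HT → HT → Type} {IsFull : ∀ {s t : HT}, LogLink s t → Prop}
  (lat : LGPGaussianLogThetaLattice LogLink IsFull)
  {Frd : Type} {IsoF : Frd → Frd → Type} {Ob : Frd → Type} {realify : Frd → Frd} {Strip : Type}
  {IsoS : Strip → Strip → Type} {Mv : ∀ v : (thetaIndexOfInitial D).V, v ∈ (thetaIndexOfInitial D).Vbad → Type}
  [∀ v h, Monoid (Mv v h)]
  (sig : GlobalLGPFrobenioidSignature (thetaIndexOfInitial D).lstar (thetaIndexOfInitial D).V
    (· ∈ (thetaIndexOfInitial D).Vbad) Frd IsoF Ob realify Strip IsoS Mv)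
  (split : SplittingMonoids Mv) {ObΔ : Type} {N : ∀ v : (thetaIndexOfInitial D).V, v ∈ (thetaIndexOfInitial D).Vbad → Type}
  [∀ v h, Monoid (N v h)] (qData : QPilotData ObΔ N)
  (t : ∀ (u : FinitePlace ℚ) (_ : Fin (thetaIndexOfInitial D).lstar) (x : (thetaIndexOfInitial D).Fibre (Val.non u)),
    kOfM D (ratChar u) u (natCast_ratChar_mem u) x)
  (tq : ∀ (u : FinitePlace ℚ) (x : (thetaIndexOfInitial D).Fibre (Val.non u)),
    kOfM D (ratChar u) u (natCast_ratChar_mem u) x)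
  (htq0 : ∀ u x, tq u x ≠ 0) (Sq : Finset (FinitePlace ℚ))
  (htq1 : ∀ (u : FinitePlace ℚ) (x : (thetaIndexOfInitial D).Fibre (Val.non u)), u ∉ Sq → ‖tq u x‖ = 1)

/-- **A capsule permutation FIXES the sharp (Ind3)-region of `settingPrVolSharpM` when the Θ-norms are constant on each fibre `V̲_u`** (over a finite
`u`: abc-iut-c312-5's `comparison_permute` / `permΨ_image_pi` + abc-iut-w5-d216's `permX_image_iota_smul_normalizedPacket` put `ι_{σ(last)}(t_{Θ,j,v̲_{σ(last)}})·(R_I)^∼`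
in each summand, and a slot-twisted box depends only on the norm of the twisting idele; at `∞` the region is everything). [cite: DupuyHilado2025, §4.7, §3.9]
[claim: Mochizuki2012, status: disputed] -/
theorem permute_image_thetaRegion3_settingPrVolSharpM_eq_of_norm_const (ht0 : ∀ u i x, t u i x ≠ 0)
    (hΘ : ∀ (u : FinitePlace ℚ) (i : Fin (thetaIndexOfInitial D).lstar) (x y : (thetaIndexOfInitial D).Fibre (Val.non u)), ‖t u i x‖ = ‖t u i y‖)
    (j : (thetaIndexOfInitial D).Label) (vQ : (thetaIndexOfInitial D).VQ) (σ : Equiv.Perm ((thetaIndexOfInitial D).Caps j)) :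
    (logShellsOfInitialDH D logvK).permute j vQ σ ''
        (settingPrVolSharpM D hlog t tq M archPk archSub Ψ act Mmod region n lat sig split qData htq0 Sq htq1).thetaRegion3 j vQ =
      (settingPrVolSharpM D hlog t tq M archPk archSub Ψ act Mmod region n lat sig split qData htq0 Sq htq1).thetaRegion3 j vQ := by
  rw [thetaRegion3_settingPrVolSharpM_eq D hlog M archPk archSub Ψ act Mmod region n lat sig split qData t tq htq0 Sq htq1 0 j vQ]
  rcases vQ with w | u
  · rw [show (settingPrVolSharpM D hlog t tq M archPk archSub Ψ act Mmod region n lat sig split qData htq0 Sq htq1).thetaRegion 0 j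
        (Sum.inl w) = Set.univ from
      thetaRegion_settingPrVolSharpM_arc D hlog M archPk archSub Ψ act Mmod region n lat sig split qData t tq htq0 Sq htq1 0 j w]
    exact Set.image_univ_of_surjective ((logShellsOfInitialDH D logvK).permute j (Val.arc w) σ).surjective
  · haveI : Nonempty ((thetaIndexOfInitial D).Caps j) := ⟨σ (Fin.last _)⟩
    rw [show (settingPrVolSharpM D hlog t tq M archPk archSub Ψ act Mmod region n lat sig split qData htq0 Sq htq1).thetaRegion 0 j
        (Sum.inr u) = (presAtM D hlog u).comparison j ⁻¹' Set.pi univ ((presAtM D hlog u).sharpBox (t u) j) from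
      thetaRegion_settingPrVolSharpM_non D hlog M archPk archSub Ψ act Mmod region n lat sig split qData t tq htq0 Sq htq1 0 j u]
    refine Cor312Vol.image_preimage_eq_of_semiconj' ((logShellsOfInitialDH D logvK).permute j (Val.non u) σ).surjective
      ((presAtM D hlog u).permΨ σ).injective ((presAtM D hlog u).comparison_permute σ) ?_
    rw [(presAtM D hlog u).permΨ_image_pi]
    refine Set.pi_congr rfl fun e _ => ?_
    show (presAtM D hlog u).permX σ e '' (presAtM D hlog u).sharpBox (t u) j (e ∘ σ) = (presAtM D hlog u).sharpBox (t u) j e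
    unfold PadicPresentation.sharpBox
    rw [(presAtM D hlog u).permX_image_iota_smul_normalizedPacket σ e (Fin.last _)]
    have hn : ‖(presAtM D hlog u).labelIdele (t u) j ((e ∘ σ) (Fin.last _))‖ = ‖(presAtM D hlog u).labelIdele (t u) j (e (Fin.last _))‖ := by
      unfold PadicPresentation.labelIdele
      split_ifs
      · exact hΘ u _ _ _
      · rw [norm_one, norm_one]
    exact Literature.IUT.LogVolume.iota_smul_normalizedPacket_eq_of_norm_eq (ratChar u) ((presAtM D hlog u).kk e)
      (DFac (ratChar u) ((presAtM D hlog u).kk e)) (dEquiv (ratChar u) ((presAtM D hlog u).kk e)) (σ (Fin.last _)) (Fin.last _)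
      ((presAtM D hlog u).labelIdele_ne_zero (t u) (ht0 u) j _) hn

/-- **(U) = (P) AS IMAGE FAMILIES on the M line under norm constancy**: at abc-iut-s2-p8's `settingPrVolSharpM` (ANY initial Θ-datum, context binders,
q-ideles, `Sq`; Θ-ideles `t ≠ 0` of constant norm on each fibre) `possibleImages j v_ℚ = thetaSlotImages j v_ℚ` at every `(j, v_ℚ)`.
[cite: Mochizuki2012, IUTchIII Thm. 3.11 (i) p. 154, Cor. 3.12 p. 173–174] [cite: DupuyHilado2025, §4.7, §4.11] [claim: Mochizuki2012, status: disputed] -/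
theorem possibleImages_settingPrVolSharpM_eq_thetaSlotImages (ht0 : ∀ u i x, t u i x ≠ 0)
    (hΘ : ∀ (u : FinitePlace ℚ) (i : Fin (thetaIndexOfInitial D).lstar) (x y : (thetaIndexOfInitial D).Fibre (Val.non u)), ‖t u i x‖ = ‖t u i y‖)
    (j : (thetaIndexOfInitial D).Label) (vQ : (thetaIndexOfInitial D).VQ) :
    (settingPrVolSharpM D hlog t tq M archPk archSub Ψ act Mmod region n lat sig split qData htq0 Sq htq1).possibleImages j vQ =
      (settingPrVolSharpM D hlog t tq M archPk archSub Ψ act Mmod region n lat sig split qData htq0 Sq htq1).thetaSlotImages j vQ := by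
  set P := settingPrVolSharpM D hlog t tq M archPk archSub Ψ act Mmod region n lat sig split qData htq0 Sq htq1 with hPdef
  obtain ⟨hS, hS', hN, hI, hI'⟩ :=
    LogShells.toDH_closure_hyps (logShellsOfInitial₁ D logvK) (topologyOfInitial D logvK)
  have key := LogShells.image_closure_eq (L := logShellsOfInitialDH D logvK) hS hS' hN hI hI' j vQ (P.thetaRegion3 j vQ)
  have hL : P.possibleImages j vQ =
      {A | ∃ Φ ∈ Subgroup.closure ((logShellsOfInitialDH D logvK).Ind1Family ∪ (logShellsOfInitialDH D logvK).Ind2Family),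
        A = Φ j vQ '' P.thetaRegion3 j vQ} :=
    rfl
  rw [hL, key]
  ext A
  constructor
  · rintro ⟨Φ₁, h₁, Φ₂, h₂, rfl⟩
    obtain ⟨σ, hσ⟩ := LogShells.exists_perm_of_mem_Ind1_toDH (logShellsOfInitial₁ D logvK) (topologyOfInitial D logvK) (h₁ j)
    refine ⟨Φ₂, h₂, ?_⟩
    rw [hσ vQ]
    show Φ₂ j vQ '' ((logShellsOfInitialDH D logvK).permute j vQ σ '' P.thetaRegion3 j vQ) = Φ₂ j vQ '' P.thetaRegion3 j vQ
    rw [hPdef, permute_image_thetaRegion3_settingPrVolSharpM_eq_of_norm_const D hlog M archPk archSub Ψ act Mmod region n lat sig split qData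
      t tq htq0 Sq htq1 ht0 hΘ j vQ σ]
  · rintro ⟨Φ₂, h₂, rfl⟩
    refine ⟨1, LogShells.one_mem_Ind1Family, Φ₂, h₂, ?_⟩
    show Φ₂ j vQ '' P.thetaRegion3 j vQ = Φ₂ j vQ '' ((LinearEquiv.refl ℚ _) '' P.thetaRegion3 j vQ)
    simp only [LinearEquiv.refl_apply, Set.image_id']

/-- Hence `negLogThetaSlot = negLogTheta` and `SlotStatement ↔ Statement` (and every other derived object coincides, by p489130's §1 transfer lemmas) on
the M line under norm constancy. [cite: Mochizuki2012, IUTchIII Cor. 3.12 p. 174 l. 16–18, Step (x) p. 181] [claim: Mochizuki2012, status: disputed] -/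
theorem negLogThetaSlot_eq_and_slotStatement_iff_settingPrVolSharpM (ht0 : ∀ u i x, t u i x ≠ 0)
    (hΘ : ∀ (u : FinitePlace ℚ) (i : Fin (thetaIndexOfInitial D).lstar) (x y : (thetaIndexOfInitial D).Fibre (Val.non u)), ‖t u i x‖ = ‖t u i y‖) :
    (settingPrVolSharpM D hlog t tq M archPk archSub Ψ act Mmod region n lat sig split qData htq0 Sq htq1).negLogThetaSlot =
        (settingPrVolSharpM D hlog t tq M archPk archSub Ψ act Mmod region n lat sig split qData htq0 Sq htq1).negLogTheta ∧
      ((settingPrVolSharpM D hlog t tq M archPk archSub Ψ act Mmod region n lat sig split qData htq0 Sq htq1).SlotStatement ↔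
        (settingPrVolSharpM D hlog t tq M archPk archSub Ψ act Mmod region n lat sig split qData htq0 Sq htq1).Statement) :=
  ⟨Cor312.Setting.negLogThetaSlot_eq_negLogTheta_of_images _
      (possibleImages_settingPrVolSharpM_eq_thetaSlotImages D hlog M archPk archSub Ψ act Mmod region n lat sig split qData t tq htq0 Sq htq1 ht0 hΘ),
    Cor312.Setting.slotStatement_iff_statement_of_images _
      (possibleImages_settingPrVolSharpM_eq_thetaSlotImages D hlog M archPk archSub Ψ act Mmod region n lat sig split qData t tq htq0 Sq htq1 ht0 hΘ)⟩

/-- **READ-U-M EXACT under norm constancy**: with the datum's own read-off Θ-ideles `tOfIdeleData D r` of constant norm on each fibre, the (U) quantity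
`−|log(Θ)|` of abc-iut-s2-p8's `settingPrVolSharpM` EQUALS Dupuy–Hilado's per-image non-archimedean number of the volume input of `r` — gen 4's READ-P-M theorem
`negLogThetaSlot_settingPrVolSharpM_tOfIdeleData_eq_negLogThetaPerImageNonarch` (p469199) transported along `negLogThetaSlot = negLogTheta`.
[cite: Mochizuki2012, IUTchIII Cor. 3.12 proof Step (x) p. 181] [cite: DupuyHilado2025, §4.12] [claim: Mochizuki2012, status: disputed] -/
theorem negLogTheta_settingPrVolSharpM_tOfIdeleData_eq_negLogThetaPerImageNonarch_of_norm_const (r : ThetaData.IdeleData D)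
    (hΘ : ∀ (u : FinitePlace ℚ) (i : Fin (thetaIndexOfInitial D).lstar) (x y : (thetaIndexOfInitial D).Fibre (Val.non u)),
      ‖tOfIdeleData D r u i x‖ = ‖tOfIdeleData D r u i y‖) :
    (settingPrVolSharpM D hlog (tOfIdeleData D r) tq M archPk archSub Ψ act Mmod region n lat sig split qData htq0 Sq htq1).negLogTheta =
      (((ThetaData.volumeInputOf D r).negLogThetaPerImageNonarch : ℝ) : WithTop ℝ) := by
  rw [← (negLogThetaSlot_eq_and_slotStatement_iff_settingPrVolSharpM D hlog M archPk archSub Ψ act Mmod region n lat sig split qData (tOfIdeleData D r)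
    tq htq0 Sq htq1 (tOfIdeleData_ne_zero D r) hΘ).1]
  exact negLogThetaSlot_settingPrVolSharpM_tOfIdeleData_eq_negLogThetaPerImageNonarch D hlog r tq M archPk archSub Ψ act Mmod region n lat sig
    split qData htq0 Sq htq1

end Thm311.Real

/-! ## §3. Every genuine datum over a rational point: subsingleton fibres, so (U) = (P) on the M line for every idele family -/

namespace Conditional

open Thm311 Thm311.Real Cor312 Cor312Vol Literature.IUT.LogThetaLattice Literature.IUT.LogVolume Literature.IUT.HodgeTheaters
open Literature.NumberTheory.DiophantineGeometry.GenEll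

/-- **(U) = (P) AS IMAGE FAMILIES at every genuine Θ-volume datum over a point with `d_mod = 1`, M line** — for ANY Θ-ideles `t ≠ 0`, ANY q-ideles, `Sq`,
context binders: the fibres `V̲_u` are subsingletons (gen 4 `GenuineMSlot.fibre_subsingleton_of_dmod_eq_one`), so norm constancy is automatic. In particular
for the M books' setting (`t := tOfIdeleData …`, `tq := tqM …`). [cite: Mochizuki2012, IUTchIII Cor. 3.12 p. 173–174; IUTchI Def. 3.1 (e) p. 62]
[cite: DupuyHilado2025, §4.11–4.12] [claim: Mochizuki2012, status: disputed] -/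
theorem GenuineMSlot.possibleImages_eq_thetaSlotImages_of_dmod_eq_one {P : NFPoint} {l : ℕ} (T : Cor22.ThetaVolumeDatumAt P l)
    (hd : Cor22.dmod P = 1)
    (M : Type) [Field M] [NumberField M]
    (archPk : letI := T.instFieldF; letI := T.instNumberFieldF; letI := T.instAlgebraF; letI := T.instFieldK;
        letI := T.instNumberFieldK; letI := T.instAlgebraK; letI := T.instFieldFbar; letI := T.instAlgebraFbar;
        letI := T.instAlgebraKFbar; letI := T.instIsElliptic;
      ∀ (j : (thetaIndexOfInitial T.D).Label) (vQ : (thetaIndexOfInitial T.D).VQ), Set ((logShellsOfInitialDH T.D (analyticLogvVal T.K)).Packet j vQ))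
    (archSub : letI := T.instFieldF; letI := T.instNumberFieldF; letI := T.instAlgebraF; letI := T.instFieldK;
        letI := T.instNumberFieldK; letI := T.instAlgebraK; letI := T.instFieldFbar; letI := T.instAlgebraFbar;
        letI := T.instAlgebraKFbar; letI := T.instIsElliptic;
      ∀ (j : (thetaIndexOfInitial T.D).Label) (v : (thetaIndexOfInitial T.D).V), Set ((logShellsOfInitialDH T.D (analyticLogvVal T.K)).Packet j ((thetaIndexOfInitial T.D).over v)))
    (Ψ : letI := T.instFieldF; letI := T.instNumberFieldF; letI := T.instAlgebraF; letI := T.instFieldK;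
        letI := T.instNumberFieldK; letI := T.instAlgebraK; letI := T.instFieldFbar; letI := T.instAlgebraFbar;
        letI := T.instAlgebraKFbar; letI := T.instIsElliptic;
      ℤ → ∀ v : (thetaIndexOfInitial T.D).V, v ∈ (thetaIndexOfInitial T.D).Vbad → Set ((logShellsOfInitialDH T.D (analyticLogvVal T.K)).StarPacket v))
    (act : letI := T.instFieldF; letI := T.instNumberFieldF; letI := T.instAlgebraF; letI := T.instFieldK;
        letI := T.instNumberFieldK; letI := T.instAlgebraK; letI := T.instFieldFbar; letI := T.instAlgebraFbar;
        letI := T.instAlgebraKFbar; letI := T.instIsElliptic;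
      ℤ → ∀ v : (thetaIndexOfInitial T.D).V, v ∈ (thetaIndexOfInitial T.D).Vbad → (logShellsOfInitialDH T.D (analyticLogvVal T.K)).StarPacket v →
        Module.End ℚ ((logShellsOfInitialDH T.D (analyticLogvVal T.K)).StarPacket v))
    (Mmod : letI := T.instFieldF; letI := T.instNumberFieldF; letI := T.instAlgebraF; letI := T.instFieldK;
        letI := T.instNumberFieldK; letI := T.instAlgebraK; letI := T.instFieldFbar; letI := T.instAlgebraFbar;
        letI := T.instAlgebraKFbar; letI := T.instIsElliptic;
      ℤ → ∀ j : (thetaIndexOfInitial T.D).LabelStar, Set ((logShellsOfInitialDH T.D (analyticLogvVal T.K)).GlobalPacket j.1))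
    (region : letI := T.instFieldF; letI := T.instNumberFieldF; letI := T.instAlgebraF; letI := T.instFieldK;
        letI := T.instNumberFieldK; letI := T.instAlgebraK; letI := T.instFieldFbar; letI := T.instAlgebraFbar;
        letI := T.instAlgebraKFbar; letI := T.instIsElliptic;
      ℤ → ∀ j : (thetaIndexOfInitial T.D).LabelStar, FinDivisor M → ∀ vQ : (thetaIndexOfInitial T.D).VQ,
        Set ((logShellsOfInitialDH T.D (analyticLogvVal T.K)).Packet j.1 vQ))
    (n : ℤ) {HT : Type} {LogLink : HT → HT → Type} {IsFull : ∀ {s t : HT}, LogLink s t → Prop}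
    (lat : LGPGaussianLogThetaLattice LogLink IsFull)
    {Frd : Type} {IsoF : Frd → Frd → Type} {Ob : Frd → Type} {realify : Frd → Frd} {Strip : Type} {IsoS : Strip → Strip → Type}
    {Mv : letI := T.instFieldF; letI := T.instNumberFieldF; letI := T.instAlgebraF; letI := T.instFieldK;
        letI := T.instNumberFieldK; letI := T.instAlgebraK; letI := T.instFieldFbar; letI := T.instAlgebraFbar;
        letI := T.instAlgebraKFbar; letI := T.instIsElliptic;
      ∀ v : (thetaIndexOfInitial T.D).V, v ∈ (thetaIndexOfInitial T.D).Vbad → Type}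
    [∀ v h, Monoid (Mv v h)]
    (sig : letI := T.instFieldF; letI := T.instNumberFieldF; letI := T.instAlgebraF; letI := T.instFieldK;
        letI := T.instNumberFieldK; letI := T.instAlgebraK; letI := T.instFieldFbar; letI := T.instAlgebraFbar;
        letI := T.instAlgebraKFbar; letI := T.instIsElliptic;
      GlobalLGPFrobenioidSignature (thetaIndexOfInitial T.D).lstar (thetaIndexOfInitial T.D).V (· ∈ (thetaIndexOfInitial T.D).Vbad) Frd IsoF Ob realify
        Strip IsoS Mv)
    (split : SplittingMonoids Mv) {ObΔ : Type}
    {N : letI := T.instFieldF; letI := T.instNumberFieldF; letI := T.instAlgebraF; letI := T.instFieldK;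
        letI := T.instNumberFieldK; letI := T.instAlgebraK; letI := T.instFieldFbar; letI := T.instAlgebraFbar;
        letI := T.instAlgebraKFbar; letI := T.instIsElliptic;
      ∀ v : (thetaIndexOfInitial T.D).V, v ∈ (thetaIndexOfInitial T.D).Vbad → Type}
    [∀ v h, Monoid (N v h)] (qData : QPilotData ObΔ N)
    (t : letI := T.instFieldF; letI := T.instNumberFieldF; letI := T.instAlgebraF; letI := T.instFieldK;
        letI := T.instNumberFieldK; letI := T.instAlgebraK; letI := T.instFieldFbar; letI := T.instAlgebraFbar;
        letI := T.instAlgebraKFbar; letI := T.instIsElliptic;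
      ∀ (u : FinitePlace ℚ) (_ : Fin (thetaIndexOfInitial T.D).lstar) (x : (thetaIndexOfInitial T.D).Fibre (Val.non u)),
        kOfM T.D (ratChar u) u (natCast_ratChar_mem u) x)
    (ht0 : ∀ u i x, t u i x ≠ 0)
    (tq : letI := T.instFieldF; letI := T.instNumberFieldF; letI := T.instAlgebraF; letI := T.instFieldK;
        letI := T.instNumberFieldK; letI := T.instAlgebraK; letI := T.instFieldFbar; letI := T.instAlgebraFbar;
        letI := T.instAlgebraKFbar; letI := T.instIsElliptic;
      ∀ (u : FinitePlace ℚ) (x : (thetaIndexOfInitial T.D).Fibre (Val.non u)), kOfM T.D (ratChar u) u (natCast_ratChar_mem u) x)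
    (htq0 : ∀ u x, tq u x ≠ 0) (Sq : Finset (FinitePlace ℚ))
    (htq1 : ∀ (u : FinitePlace ℚ) (x : letI := T.instFieldF; letI := T.instNumberFieldF; letI := T.instAlgebraF; letI := T.instFieldK;
        letI := T.instNumberFieldK; letI := T.instAlgebraK; letI := T.instFieldFbar; letI := T.instAlgebraFbar;
        letI := T.instAlgebraKFbar; letI := T.instIsElliptic; (thetaIndexOfInitial T.D).Fibre (Val.non u)), u ∉ Sq → ‖tq u x‖ = 1)
    (j : letI := T.instFieldF; letI := T.instNumberFieldF; letI := T.instAlgebraF; letI := T.instFieldK;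
        letI := T.instNumberFieldK; letI := T.instAlgebraK; letI := T.instFieldFbar; letI := T.instAlgebraFbar;
        letI := T.instAlgebraKFbar; letI := T.instIsElliptic; (thetaIndexOfInitial T.D).Label)
    (vQ : letI := T.instFieldF; letI := T.instNumberFieldF; letI := T.instAlgebraF; letI := T.instFieldK;
        letI := T.instNumberFieldK; letI := T.instAlgebraK; letI := T.instFieldFbar; letI := T.instAlgebraFbar;
        letI := T.instAlgebraKFbar; letI := T.instIsElliptic; (thetaIndexOfInitial T.D).VQ) :
    letI := T.instFieldF; letI := T.instNumberFieldF; letI := T.instAlgebraF; letI := T.instFieldK;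
    letI := T.instNumberFieldK; letI := T.instAlgebraK; letI := T.instFieldFbar; letI := T.instAlgebraFbar;
    letI := T.instAlgebraKFbar; letI := T.instIsElliptic;
    (settingPrVolSharpM T.D (logvAnalyticVal_analyticLogvVal (K := T.K)) t tq M archPk archSub Ψ act Mmod region n lat sig split qData htq0 Sq
        htq1).possibleImages j vQ =
      (settingPrVolSharpM T.D (logvAnalyticVal_analyticLogvVal (K := T.K)) t tq M archPk archSub Ψ act Mmod region n lat sig split qData htq0 Sq
        htq1).thetaSlotImages j vQ := by
  letI := T.instFieldF; letI := T.instNumberFieldF; letI := T.instAlgebraF; letI := T.instFieldK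
  letI := T.instNumberFieldK; letI := T.instAlgebraK; letI := T.instFieldFbar; letI := T.instAlgebraFbar
  letI := T.instAlgebraKFbar; letI := T.instIsElliptic
  exact possibleImages_settingPrVolSharpM_eq_thetaSlotImages T.D (logvAnalyticVal_analyticLogvVal (K := T.K)) M archPk archSub Ψ act Mmod region n
    lat sig split qData t tq htq0 Sq htq1 ht0 (fun u i x y => by rw [GenuineMSlot.fibre_subsingleton_of_dmod_eq_one T hd u x y]) j vQ

end Conditional

end Summit.ABC.IUTFork

end
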